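import Literature.MathematicalPhysics.QuantumFieldTheory.Balaban1983to89.T4ActivityTermReach
import HarnessLib

/-!
# Balaban T⁴ spine, estimate NE5 (node U3): the located wall `ActivityLipschitz₂` (G-ne5p2-3′) MADE A THEOREM for
# the TERM MODEL — part 1 of 3: the datum of one (2.14)-term, its functional, the tilt identities, the hypothesis shapes

Cell `pub-balaban`, unit `b2b-balaban-t4-ne5-p2-g15` (prover seat P2, generation 15).  Summits-side NEW WORK (placement
rule 2026-08-19: `Literature/` holds only published results; this junction is modelling + bookkeeping and cites print for
KIND only).  HONEST FRAMING: rung (B)+1 of the FINITE-VOLUME T⁴ continuum programme — NOT infinite volume, NOT a mass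
gap, NOT the Clay problem, and NOT a proof of NE5: the value is a typed junction that turns the activity route's ONE
not-printed activity-level input into a theorem about an explicit model, leaving the two-run RATES and the two-run
bookkeeping as the named remaining inputs.

WHAT THE THREE FILES DO.  The activity route (`T4ActivityRecursion` → `T4ActivityThreshold`) closes NE5 from one-run
printed-KIND inputs plus: `Represents`/`Realizes` (two-run bookkeeping, cell MI-R), the two-run rates `OperatorRate` /
`InsertionRate` / `InsScaleBound`, and the activity-level slot `InputModel.ActivityLipschitz₂ W m Λop Λhist ρ₀` with its
majorant `BaseMajorant W m` (G-ne5p2-3′: NOT PRINTED as a statement — print bounds ONE run's activities, (2.15) p. 15 of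
[Balaban1988RG2Cluster]).  §§11–12 of the Literature lineage (`T4ActivityTilt*`, `T4ActivityReach`, `T4ActivityTermReach`)
proved, for ONE ABSTRACT TERM of the (2.14) representation, the two-species slot `termSlot_of_reach` from reference data
at the BASE point only.  Here:
* (1, this file) `TermDatum` = the data of one term READ from the two-species input point `(o, h) ∈ Op × Hist` (kernel
  read-outs `kL kA kP kQ kR`, history read-out `read`, Gaussian data); its functional
  `term (o, h) = z(o)⁻¹ • ∫ e^{−(opForm o x + histForm h x)} • F₀ x dν`, `z(o) = ∫ e^{−quad₀ (kP o)} • φ₀ dν₀`; the identities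
  `F_eq_tilt` / `φ_eq_tilt` (the displaced term IS the base term tilted by DIFFERENCE data — the format `termSlot_of_reach`
  consumes); the constants `TermConsts` with their `Admissible` range; the hypothesis shapes `Geometry` (one-run lattice
  bookkeeping), `ReadLip` (how the input is normed: read-outs Lipschitz in margin units), `RefAt pt` (printed-KIND
  reference data at a point = `Base` membership of the model); the amplitudes `ampOp`, `ampHist` and the size `M′/ζ`.
* (2, `ActivityTermSlot`) `norm_term_sub_le`: `Admissible + Geometry + ReadLip + RefAt pt` ⟹ for every `qt` within relative
  reach (`‖qt.1 − pt.1‖/ϱOp ≤ 1`, `‖qt.2 − pt.2‖/ϱHist ≤ ρ₀`): `‖term qt − term pt‖ ≤ ampOp ρ₀ · δ_op + ampHist ρ₀ · δ_h`,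
  NOTHING assumed at `qt`; `norm_term_le`: `‖term pt‖ ≤ M′/ζ`.
* (3, `ActivityTermModel`) `TermFamily.model : InputModel` (activities = finite sums of terms; `Base` = reference data for
  every term) and the THEOREMS `activityLipschitz₂_model`, `baseMajorant_model` (from well-formedness and `Σ_i G_i ≤ m`),
  hence `ne5_at_max_of_model_reach` = the route's closure with `hlip`, `hmaj` DISCHARGED.

DICTIONARY (print ↦ here; B13 = [Balaban1988RG2Cluster]): one term of `ρ(γ)` in (2.14) p. 15 ↦ `TermDatum.term`; the
background-dependent operators and the covariance of (2.16)–(2.17) p. 16 ↦ read-outs `kL o`, `kA o`, `kP o`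
(`Γ o = mulKer (kL o) (sqrtKer (kA o))`, `R₁ o = sandwichKer (Γ o) (kP o)⁻¹`, §11's kernel formats); the localized
potentials of (2.19) p. 16 and their remainders ↦ `kQ o x Y`, `kR o x Y` with weights `τ Y`; the earlier actions entering
through (1.23) p. 7 and (1.33) p. 9 ↦ `read h Y x`; the analyticity margins (2.18) p. 16 ↦ `ϱOp`, `ϱHist`; the one-run
bound (2.15) p. 15 ↦ `RefAt` + `size`; the pins of (2.20) p. 16 ↦ `Geometry.hmeet` / `hpin`.

STATUS OF EVERY HYPOTHESIS (absolute rule: nothing internally minted is cited; B13 is cited for KIND, never for a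
disputed step).  `Admissible`, `Geometry`, `ReadLip`, `RefAt` (and `WellFormed`, `Σ G ≤ m` in part 3) are HYPOTHESIS
SHAPES — binders, asserted nowhere.  PRINTED KIND for one run: `RefAt` ((2.15)–(2.26) pp. 15–18), `Geometry` ((2.20)),
read-out additivity ((1.23), (1.33)).  Nothing NOT-PRINTED is introduced: the remaining not-printed inputs of the closure
are the siblings' `OperatorRate` / `InsertionRate` / `InsScaleBound` and MI-R's `Represents` / `Realizes`, BY NAME.  The
reach condition `Admissible.hreach` (the normalisation cannot degenerate inside the operator box) is a condition on the
MARGIN: the moduli `κ•` of `ReadLip` scale with `ϱOp`, so it is met by shrinking `ϱOp` — paid for in `OperatorRate`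
(displacements are measured in margin units); that trade-off is the siblings' and is not hidden here.  The programme's
conditionals (BetaPertH, (B), (B^μ)) do not enter these files; they enter where the coupling window `W` is instantiated.
No `sorry`, no new axioms; the three parts were kernel-checked on the farm as one unit.
-/

open MeasureTheory
open scoped BigOperators

namespace Summit.QuantumFields.BalabanUV.T4Continuum.ActivityTermModel


open Literature.MathematicalPhysics.QuantumFieldTheory.Balaban1983to89.T4ActivityTilt
  (diffForm domForm domForm_nonneg sandwichKer mulKer sqrtKer lorentz)
open Literature.MathematicalPhysics.QuantumFieldTheory.Balaban1983to89.T4ActivityTilt renaming resolvent → kerResolvent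
open Literature.MathematicalPhysics.QuantumFieldTheory.Balaban1983to89.T4ActivityTiltPotential (potSum potSum_sub)
open Literature.MathematicalPhysics.QuantumFieldTheory.Balaban1983to89.T4ActivityTiltHistory
  (histPot histPot_sub ReadAdditive ReadUnitBound read_sub_of_additive norm_histPot_read_sub_le)
open Literature.MathematicalPhysics.QuantumFieldTheory.Balaban1983to89.T4ActivityTermReach (termSlot_of_reach)

variable {Op Hist ι κ S Ω Ω₀ 𝒴 𝒞 : Type*} [Fintype ι] [Fintype κ] [MeasurableSpace Ω] [MeasurableSpace Ω₀]

/-! ## §(a) The datum of one term and its functional -/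

/-- HYPOTHESIS-CARRYING DATA (no inequality inside): ONE TERM of the kernel term model, in the (2.14)-term SHAPE of
`T4ActivityTilt`'s header.  Lattice bookkeeping `d, p, q` (pseudo-metric on sites, sites of the `X`- and `B`-variables);
the three Gaussian kernels READ OUT of the operator slot `o : Op` — `kL o` (the `κ × ι` constituent `M` of `Γ = M·A^{−1/2}`),
`kA o` (the `ι × ι` kernel under the square root), `kP o` (the `κ × κ` covariance of the `B`-Gaussian and of the
normalisation); the potential bookkeeping `D, bonds, cubes, cubes₀, τ` of (2.14)'s last exponential with the (2.19)-kernels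
`kQ o x` and the operator part `kR o x` of `𝐕″` read out of `o` (they may depend on the integration point), weights
`w, kk, v`; the history read-out `read h Y x` (the earlier actions' part of `𝐕″`, `T4ActivityTiltHistory` §12.2); the
integration data: `ν, F₀, Xf, Bf` (the term's measure, untilted integrand and real Gaussian variables) and `ν₀, φ₀, B₀f`
(the normalisation's).  A MODEL: nothing of [Balaban1988RG2Cluster] is asserted about it. [folklore] -/
structure TermDatum (Op Hist ι κ S Ω Ω₀ 𝒴 𝒞 : Type*) [MeasurableSpace Ω] [MeasurableSpace Ω₀] where
  d : S → S → ℝ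
  p : ι → S
  q : κ → S
  kL : Op → κ → ι → ℂ
  kA : Op → Matrix ι ι ℂ
  kP : Op → Matrix κ κ ℂ
  D : Finset 𝒴
  bonds : 𝒴 → Finset κ
  cubes : 𝒴 → Finset 𝒞
  cubes₀ : Finset 𝒞
  τ : 𝒴 → ℂ
  kQ : Op → Ω → 𝒴 → κ → κ → ℂ
  kR : Op → Ω → 𝒴 → ℂ
  w : 𝒴 → ℝ
  kk : κ → κ → ℝ
  v : 𝒴 → ℝ
  read : Hist → 𝒴 → Ω → ℂ
  ν : Measure Ω
  F₀ : Ω → ℂ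
  Xf : Ω → ι → ℝ
  Bf : Ω → κ → ℝ
  ν₀ : Measure Ω₀
  φ₀ : Ω₀ → ℂ
  B₀f : Ω₀ → κ → ℝ

namespace TermDatum

variable (𝔱 : TermDatum Op Hist ι κ S Ω Ω₀ 𝒴 𝒞)

/-- The composite kernel `Γ(o) = kL o · (kA o)^{−1/2}` (`T4ActivityTilt.mulKer`/`sqrtKer`). [folklore] -/
noncomputable def Γ [DecidableEq ι] (o : Op) : κ → ι → ℂ := mulKer (𝔱.kL o) (sqrtKer (𝔱.kA o))

/-- The kernel of the first quadratic form, `Γ(o)ᵀ (kP o)⁻¹ Γ(o)` (`T4ActivityTilt.sandwichKer`). [folklore] -/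
noncomputable def R₁ [DecidableEq ι] [DecidableEq κ] (o : Op) : ι → ι → ℂ := sandwichKer (𝔱.Γ o) ((𝔱.kP o)⁻¹ : Matrix κ κ ℂ)

/-- The OPERATOR-dependent exponent of the term at slot `o` and integration point `x`: the full Gaussian form
`½⟨X, R₁(o)X⟩ + ½⟨B, kP o B⟩ + ⟨B, Γ(o)X⟩` (`diffForm` of the FULL kernels) plus the potential sum of the (2.19)-kernels and
the operator part of `𝐕″`. [folklore] -/
noncomputable def opForm [DecidableEq ι] [DecidableEq κ] (o : Op) (x : Ω) : ℂ :=
  diffForm (𝔱.R₁ o) (𝔱.kP o) (𝔱.Γ o) (𝔱.Xf x) (𝔱.Bf x) + potSum 𝔱.D 𝔱.bonds 𝔱.τ (𝔱.kQ o x) (𝔱.kR o x) (𝔱.Bf x)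

/-- The HISTORY-dependent exponent: `Σ_{Y∈𝐃} τ(Y)·read h Y x` (`T4ActivityTiltHistory.histPot`). [folklore] -/
def histForm (h : Hist) (x : Ω) : ℂ := histPot 𝔱.D 𝔱.τ (fun Y => 𝔱.read h Y x)

/-- The tilted integrand of the term at the input point `pt = (o, h)`. [folklore] -/
noncomputable def F [DecidableEq ι] [DecidableEq κ] (pt : Op × Hist) (x : Ω) : ℂ := Complex.exp (-(𝔱.opForm pt.1 x + 𝔱.histForm pt.2 x)) • 𝔱.F₀ x

/-- The quadratic form of the normalisation's Gaussian at covariance kernel `P`: `½ Σ_a Σ_a′ B₀(a) P(a,a′) B₀(a′)`. [folklore] -/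
noncomputable def quad₀ (P : Matrix κ κ ℂ) (B₀ : κ → ℝ) : ℂ := (1 / 2 : ℂ) * ∑ a, ∑ a', (B₀ a : ℂ) * P a a' * (B₀ a' : ℂ)

/-- The normalisation's integrand at slot `o`. [folklore] -/
noncomputable def φ (o : Op) (y : Ω₀) : ℂ := Complex.exp (-quad₀ (𝔱.kP o) (𝔱.B₀f y)) • 𝔱.φ₀ y

/-- The normalisation `z(o) = ∫ φ(o) dν₀`. [folklore] -/
noncomputable def z (o : Op) : ℂ := ∫ y, 𝔱.φ o y ∂𝔱.ν₀

/-- THE TERM: `T(o, h) = z(o)⁻¹ • ∫ F(o, h) dν` — a normalised tilted Gaussian-type integral in the (2.14)-term shape, as a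
function of the two-species input point. [folklore] -/
noncomputable def term [DecidableEq ι] [DecidableEq κ] (pt : Op × Hist) : ℂ := (𝔱.z pt.1)⁻¹ • ∫ x, 𝔱.F pt x ∂𝔱.ν

/-! ## §(b) Algebraic identifications: the displaced term IS the reference term tilted by the DIFFERENCE data -/

omit [MeasurableSpace Ω] [MeasurableSpace Ω₀] in
/-- [folklore] (bookkeeping) `diffForm` is linear in its three kernels: difference of the full forms of two kernel triples =
`diffForm` of the difference kernels (the middle kernel typed as a square matrix, as the covariance is). -/
theorem diffForm_sub (R₁ R₁' : ι → ι → ℂ) (R₂ R₂' : Matrix κ κ ℂ) (R₃ R₃' : κ → ι → ℂ) (X : ι → ℝ) (B : κ → ℝ) :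
    diffForm R₁ R₂ R₃ X B - diffForm R₁' R₂' R₃' X B = diffForm (R₁ - R₁') (R₂ - R₂') (R₃ - R₃') X B := by
  simp only [diffForm, Pi.sub_apply, Matrix.sub_apply, mul_sub, sub_mul, Finset.sum_sub_distrib, Finset.mul_sum]
  ring

omit [Fintype ι] [MeasurableSpace Ω] [MeasurableSpace Ω₀] in
/-- [folklore] (bookkeeping) `quad₀` is linear in the kernel. -/
theorem quad₀_sub (P P' : Matrix κ κ ℂ) (B₀ : κ → ℝ) : quad₀ P B₀ - quad₀ P' B₀ = quad₀ (P - P') B₀ := by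
  simp only [quad₀, Matrix.sub_apply, mul_sub, sub_mul, Finset.sum_sub_distrib, Finset.mul_sum]

/-- [folklore] (bookkeeping) The operator exponents of two slots differ by the `diffForm` of the DIFFERENCE kernels plus the
potential sum of the DIFFERENCE (2.19)-kernels and `𝐕″`-parts — the two channels of `T4ActivityTermReach.termSlot_of_reach`. -/
theorem opForm_sub [DecidableEq ι] [DecidableEq κ] (o o' : Op) (x : Ω) :
    𝔱.opForm o x - 𝔱.opForm o' x =
      diffForm (𝔱.R₁ o - 𝔱.R₁ o') (𝔱.kP o - 𝔱.kP o') (𝔱.Γ o - 𝔱.Γ o') (𝔱.Xf x) (𝔱.Bf x)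
        + potSum 𝔱.D 𝔱.bonds 𝔱.τ (𝔱.kQ o x - 𝔱.kQ o' x) (𝔱.kR o x - 𝔱.kR o' x) (𝔱.Bf x) := by
  calc 𝔱.opForm o x - 𝔱.opForm o' x
      = (diffForm (𝔱.R₁ o) (𝔱.kP o) (𝔱.Γ o) (𝔱.Xf x) (𝔱.Bf x) - diffForm (𝔱.R₁ o') (𝔱.kP o') (𝔱.Γ o') (𝔱.Xf x) (𝔱.Bf x))
        + (potSum 𝔱.D 𝔱.bonds 𝔱.τ (𝔱.kQ o x) (𝔱.kR o x) (𝔱.Bf x)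
            - potSum 𝔱.D 𝔱.bonds 𝔱.τ (𝔱.kQ o' x) (𝔱.kR o' x) (𝔱.Bf x)) := by
        unfold opForm; ring
    _ = _ := by rw [diffForm_sub, potSum_sub]

omit [Fintype ι] [Fintype κ] in
/-- [folklore] (bookkeeping) The history exponents of two histories differ by the `histPot` of the read difference. -/
theorem histForm_sub (h h' : Hist) (x : Ω) :
    𝔱.histForm h x - 𝔱.histForm h' x = histPot 𝔱.D 𝔱.τ (fun Y => 𝔱.read h Y x - 𝔱.read h' Y x) := by
  unfold histForm
  rw [histPot_sub]
  rfl

/-- [folklore] (bookkeeping) THE TILT IDENTITY: the displaced integrand is the reference integrand tilted by the exponent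
DIFFERENCES, `F(q) = e^{−(Δ_op + Δ_h)} • F(p)` pointwise. -/
theorem F_eq_tilt [DecidableEq ι] [DecidableEq κ] (pt qt : Op × Hist) (x : Ω) :
    𝔱.F qt x = Complex.exp (-((𝔱.opForm qt.1 x - 𝔱.opForm pt.1 x) + (𝔱.histForm qt.2 x - 𝔱.histForm pt.2 x)))
      • 𝔱.F pt x := by
  unfold F
  rw [smul_smul, ← Complex.exp_add]
  congr 2
  ring

omit [Fintype ι] in
/-- [folklore] (bookkeeping) The normalisation's tilt identity: `φ(q) = e^{−quad₀(kP q − kP p)} • φ(p)` pointwise. -/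
theorem φ_eq_tilt (o o' : Op) (y : Ω₀) :
    𝔱.φ o y = Complex.exp (-quad₀ (𝔱.kP o - 𝔱.kP o') (𝔱.B₀f y)) • 𝔱.φ o' y := by
  unfold φ
  rw [smul_smul, ← Complex.exp_add, ← quad₀_sub]
  congr 2
  ring

/-! ## §(c) The constants of a term, the admissible range, the one-run geometry, the READ-OUT LIPSCHITZ structure of the
## slot, the REFERENCE DATA at an input point, and the slot amplitudes -/

end TermDatum

/-- HYPOTHESIS-CARRYING DATA (no inequality inside): the real constants of one term — kernel sizes and rates of the
reference run (`m, a, c, cP, δ, K`), displacement moduli of the read-outs (`κL, κA, κP, κQ, κR`), a-priori inverse /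
resolvent sizes within reach (`c', cP'`) and the Gaussian discrepancy constant (`cG`), potential weights' sums
(`W, Kk, K''`), the exponential-moment rooms of the term (`u < u'`, majorant `M'`) and of its normalisation
(`u₀ < u₀'`, majorant `M₀'`), and the floor `ζ` of the normalisation's modulus. [folklore] -/
structure TermConsts where
  (m κL a c c' κA cP cP' κP δ K cG κQ κR W Kk K'' u u' M' u₀ u₀' M₀' ζ : ℝ)

namespace TermConsts

/-- HYPOTHESIS SHAPE (conditions among the constants only; asserted nowhere): signs, the two Neumann smallnesses of the
reach (`c κ_A K² < 1`, `c_P κ_P K² < 1`) with the a-priori sizes `c', cP'` and the discrepancy constant `cG` they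
produce (`T4ActivityTermReach.norm_diffForm_le_of_reach_linear`), the ROOMS `u + (cG + κQ W Kk) ≤ u'`,
`u₀ + κP K ≤ u₀'` and the REACH of the normalisation `2·(κP K/(e u₀))·2M₀' ≤ ζ` — uniform over relative operator
displacements `t ≤ 1`. [folklore] -/
@[folklore]
structure Admissible (𝔠 : TermConsts) : Prop where
  hm : 0 ≤ 𝔠.m
  hκL : 0 ≤ 𝔠.κL
  ha : 0 < 𝔠.a
  hc : 0 ≤ 𝔠.c
  hκA : 0 ≤ 𝔠.κA
  hcP : 0 ≤ 𝔠.cP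
  hκP : 0 ≤ 𝔠.κP
  hδ : 0 ≤ 𝔠.δ
  hK : 0 ≤ 𝔠.K
  hκQ : 0 ≤ 𝔠.κQ
  hκR : 0 ≤ 𝔠.κR
  hW : 0 ≤ 𝔠.W
  hKk : 0 ≤ 𝔠.Kk
  hK'' : 0 ≤ 𝔠.K''
  hu : 0 < 𝔠.u
  hu₀ : 0 < 𝔠.u₀
  hM' : 0 ≤ 𝔠.M'
  hM₀' : 0 ≤ 𝔠.M₀'
  hζ : 0 < 𝔠.ζ
  hsA : 𝔠.c * 𝔠.κA * 𝔠.K ^ 2 < 1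
  hsP : 𝔠.cP * 𝔠.κP * 𝔠.K ^ 2 < 1
  hc' : 𝔠.c / (1 - 𝔠.c * 𝔠.κA * 𝔠.K ^ 2) ≤ 𝔠.c'
  hcP' : 𝔠.cP / (1 - 𝔠.cP * 𝔠.κP * 𝔠.K ^ 2) ≤ 𝔠.cP'
  hcG : ((2 * ((𝔠.m + 𝔠.κL) * (𝔠.c' * Real.sqrt 𝔠.a) * 𝔠.K) * 𝔠.cP'
            * ((𝔠.κL * (𝔠.c' * Real.sqrt 𝔠.a) + (𝔠.m + 𝔠.κL) * (𝔠.c' ^ 2 * Real.sqrt 𝔠.a * 𝔠.κA * 𝔠.K ^ 2)) * 𝔠.K)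
          + ((𝔠.m + 𝔠.κL) * (𝔠.c' * Real.sqrt 𝔠.a) * 𝔠.K) ^ 2 * (𝔠.cP' * 𝔠.κP * 𝔠.cP' * 𝔠.K ^ 2)) * 𝔠.K ^ 2 * 𝔠.K
          + 𝔠.κP * 𝔠.K
          + (𝔠.κL * (𝔠.c' * Real.sqrt 𝔠.a) + (𝔠.m + 𝔠.κL) * (𝔠.c' ^ 2 * Real.sqrt 𝔠.a * 𝔠.κA * 𝔠.K ^ 2)) * 𝔠.K * 𝔠.K)
        ≤ 𝔠.cG
  huu' : 𝔠.u + (𝔠.cG + 𝔠.κQ * 𝔠.W * 𝔠.Kk) ≤ 𝔠.u'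
  hu₀u₀' : 𝔠.u₀ + 𝔠.κP * 𝔠.K ≤ 𝔠.u₀'
  hreach : 2 * (𝔠.κP * 𝔠.K / (Real.exp 1 * 𝔠.u₀) * (𝔠.M₀' + 𝔠.M₀')) ≤ 𝔠.ζ

/-- THE SIZE of the term at admissible points, `M′/ζ`. [folklore] -/
noncomputable def size (𝔠 : TermConsts) : ℝ := 𝔠.M' / 𝔠.ζ

end TermConsts

namespace TermDatum

variable (𝔱 : TermDatum Op Hist ι κ S Ω Ω₀ 𝒴 𝒞) (𝔠 : TermConsts)

/-- HYPOTHESIS SHAPE (one-run geometric and measurability bookkeeping of the term; asserted nowhere): `d` a pseudo-metric,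
the `δ/8`-rate lattice sums over the variables' sites `≤ K`, the potential weights nonnegative with bond sums `≤ W`, row and
column sums `≤ Kk`, pinned sums `≤ K''` and every localization domain meeting a cube of `Y₀` ((2.20)'s pins), and
(a.e.-strong) measurability of the dominating form, of every operator exponent, every history exponent, every
normalisation form. [folklore] -/
@[folklore]
structure Geometry [DecidableEq ι] [DecidableEq κ] [DecidableEq 𝒞] : Prop where
  hd0 : ∀ s t, 0 ≤ 𝔱.d s t
  hsymm : ∀ s t, 𝔱.d s t = 𝔱.d t s
  htri : ∀ s t w, 𝔱.d s w ≤ 𝔱.d s t + 𝔱.d t w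
  hKι : ∀ s, ∑ b, Real.exp (-(𝔠.δ / 8 * 𝔱.d s (𝔱.p b))) ≤ 𝔠.K
  hKκ : ∀ s, ∑ a', Real.exp (-(𝔠.δ / 8 * 𝔱.d s (𝔱.q a'))) ≤ 𝔠.K
  hw : ∀ Y ∈ 𝔱.D, 0 ≤ 𝔱.w Y
  hk : ∀ b b', 0 ≤ 𝔱.kk b b'
  hW : ∀ b, ∑ Y ∈ 𝔱.D.filter (fun Y => b ∈ 𝔱.bonds Y), 𝔱.w Y ≤ 𝔠.W
  hrow : ∀ b, ∑ b', 𝔱.kk b b' ≤ 𝔠.Kk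
  hcol : ∀ b', ∑ b, 𝔱.kk b b' ≤ 𝔠.Kk
  hv : ∀ Y ∈ 𝔱.D, 0 ≤ 𝔱.v Y
  hmeet : ∀ Y ∈ 𝔱.D, ∃ c ∈ 𝔱.cubes₀, c ∈ 𝔱.cubes Y
  hpin : ∀ c ∈ 𝔱.cubes₀, ∑ Y ∈ 𝔱.D.filter (fun Y => c ∈ 𝔱.cubes Y), 𝔱.v Y ≤ 𝔠.K''
  hPm : AEStronglyMeasurable (fun x => domForm (𝔱.Xf x) (𝔱.Bf x)) 𝔱.ν
  hopm : ∀ o, AEStronglyMeasurable (fun x => 𝔱.opForm o x) 𝔱.ν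
  hhistm : ∀ h, AEStronglyMeasurable (fun x => 𝔱.histForm h x) 𝔱.ν
  hq₀m : ∀ P : Matrix κ κ ℂ, AEStronglyMeasurable (fun y => quad₀ P (𝔱.B₀f y)) 𝔱.ν₀
  hP₀m : AEStronglyMeasurable (fun y => (∑ a, 𝔱.B₀f y a ^ 2) / 2) 𝔱.ν₀

/-- HYPOTHESIS SHAPE **READ-OUT LIPSCHITZ** (the modelling of the SLOT; asserted nowhere): in operator-margin units
`‖o − o′‖/ϱOp` the kernel read-outs move by at most `κ•` times the ENTRY WEIGHTS of their one-run decay formats — `kL` at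
rate `2δ`, `kA` at rate `2δ`, `kP` at rate `δ`, the (2.19)-kernels in the `w(Y)·k(b,b′)` format and the operator part of
`𝐕″` in the `v(Y)` format, uniformly in the integration point —, and the history read-out is ADDITIVE with the one-run-KIND
unit bound in history-margin units (`T4ActivityTiltHistory.ReadAdditive`/`ReadUnitBound`).  For read-outs that are
bounded-linear in the input these hold BY CONSTRUCTION (`read_of_clm` in `ActivityTermModel`); in general they say how
the operator input is NORMED.
The two-run RATE content of the route is NOT here: it is the size of the actual runs' displacement `‖opA − opB‖/ϱOp`
(`InputModel.OperatorRate`). [folklore] -/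
@[folklore]
structure ReadLip [NormedAddCommGroup Op] [NormedAddCommGroup Hist] (ϱOp ϱHist : ℝ) : Prop where
  hkL : ∀ (o o' : Op) (a' : κ) (i : ι),
    ‖𝔱.kL o a' i - 𝔱.kL o' a' i‖ ≤ 𝔠.κL * (‖o - o'‖ / ϱOp) * Real.exp (-(2 * 𝔠.δ * 𝔱.d (𝔱.q a') (𝔱.p i)))
  hkA : ∀ (o o' : Op) (i j : ι),
    ‖𝔱.kA o i j - 𝔱.kA o' i j‖ ≤ 𝔠.κA * (‖o - o'‖ / ϱOp) * Real.exp (-(2 * 𝔠.δ * 𝔱.d (𝔱.p i) (𝔱.p j)))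
  hkP : ∀ (o o' : Op) (a' a'' : κ),
    ‖𝔱.kP o a' a'' - 𝔱.kP o' a' a''‖ ≤ 𝔠.κP * (‖o - o'‖ / ϱOp) * Real.exp (-(𝔠.δ * 𝔱.d (𝔱.q a') (𝔱.q a'')))
  hkQ : ∀ (o o' : Op) (x : Ω), ∀ Y ∈ 𝔱.D, ∀ b ∈ 𝔱.bonds Y, ∀ b' ∈ 𝔱.bonds Y,
    ‖𝔱.τ Y * (𝔱.kQ o x Y b b' - 𝔱.kQ o' x Y b b')‖ ≤ 𝔠.κQ * (‖o - o'‖ / ϱOp) * (𝔱.w Y * 𝔱.kk b b')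
  hkR : ∀ (o o' : Op) (x : Ω), ∀ Y ∈ 𝔱.D, ‖𝔱.τ Y * (𝔱.kR o x Y - 𝔱.kR o' x Y)‖ ≤ 𝔠.κR * (‖o - o'‖ / ϱOp) * 𝔱.v Y
  hadd : ReadAdditive 𝔱.read
  hunit : ReadUnitBound 𝔱.read 𝔱.D 𝔱.τ 𝔱.v ϱHist

/-- HYPOTHESIS SHAPE **REFERENCE DATA AT AN INPUT POINT** (printed KIND for ONE run — [Balaban1988RG2Cluster] (2.16)–(2.26)
pp. 16–18 bound one run's kernels, Gaussian integrals and normalisations at its own data; asserted nowhere, and for the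
model's kernels nothing is claimed): at `pt = (o, h)` the constituent `kL o` decays at rate `2δ` with size `m`, the
resolvent family of `kA o` exists and decays at rate `2δ` with Lorentzian amplitude `c·a/(a+v²)`, the covariance `kP o` is
invertible with inverse decaying at rate `δ` and size `cP`; the tilted integrand `F(pt)` is integrable with exponential-moment
majorant `∫ e^{u′P}‖F‖ ≤ M′` (ROOM `u′ > u`), the normalisation integrand likewise with `∫ e^{u₀′P₀}‖φ‖ ≤ M₀′`, and the
normalisation's modulus is at least the floor, `ζ ≤ ‖z(o)‖`.  This is `Base`-membership of the term model. [folklore] -/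
@[folklore]
structure RefAt [DecidableEq ι] [DecidableEq κ] (pt : Op × Hist) : Prop where
  hL : ∀ a' i, ‖𝔱.kL pt.1 a' i‖ ≤ 𝔠.m * Real.exp (-(2 * 𝔠.δ * 𝔱.d (𝔱.q a') (𝔱.p i)))
  hRA : ∀ v i j, ‖kerResolvent (𝔱.kA pt.1) v i j‖
    ≤ 𝔠.c * lorentz 𝔠.a v * Real.exp (-(2 * 𝔠.δ * 𝔱.d (𝔱.p i) (𝔱.p j)))
  hdA : ∀ u : ℝ, IsUnit (((u ^ 2 : ℝ) : ℂ) • (1 : Matrix ι ι ℂ) + 𝔱.kA pt.1).det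
  hP : IsUnit (𝔱.kP pt.1).det
  hC : ∀ a' a'', ‖((𝔱.kP pt.1)⁻¹ : Matrix κ κ ℂ) a' a''‖ ≤ 𝔠.cP * Real.exp (-(𝔠.δ * 𝔱.d (𝔱.q a') (𝔱.q a'')))
  hF : Integrable (𝔱.F pt) 𝔱.ν
  hI' : Integrable (fun x => Real.exp (𝔠.u' * domForm (𝔱.Xf x) (𝔱.Bf x)) * ‖𝔱.F pt x‖) 𝔱.ν
  hM' : ∫ x, Real.exp (𝔠.u' * domForm (𝔱.Xf x) (𝔱.Bf x)) * ‖𝔱.F pt x‖ ∂𝔱.ν ≤ 𝔠.M'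
  hφ : Integrable (𝔱.φ pt.1) 𝔱.ν₀
  hI0' : Integrable (fun y => Real.exp (𝔠.u₀' * ((∑ a, 𝔱.B₀f y a ^ 2) / 2)) * ‖𝔱.φ pt.1 y‖) 𝔱.ν₀
  hM0' : ∫ y, Real.exp (𝔠.u₀' * ((∑ a, 𝔱.B₀f y a ^ 2) / 2)) * ‖𝔱.φ pt.1 y‖ ∂𝔱.ν₀ ≤ 𝔠.M₀'
  hζ : 𝔠.ζ ≤ ‖𝔱.z pt.1‖

/-- The history modulus of the term, `n₀·K″` (`n₀ = #cubes₀`; (2.20)'s volume term per unit of relative history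
displacement, `T4ActivityTiltHistory.norm_histPot_read_sub_le`). [folklore] -/
noncomputable def n₀K : ℝ := (𝔱.cubes₀.card : ℝ) * 𝔠.K''

/-- The uniform bound of the constant parts of the tilt within reach `ρ₀` (`t ≤ 1`): `κR·n₀K″ + n₀K″·ρ₀`. [folklore] -/
noncomputable def βbar (ρ₀ : ℝ) : ℝ := 𝔠.κR * 𝔱.n₀K 𝔠 + 𝔱.n₀K 𝔠 * ρ₀

/-- THE OPERATOR AMPLITUDE of the term's two-species slot (the coefficient of `t = ‖q.1 − p.1‖/ϱOp` in
`T4ActivityTermReach.termSlot_of_reach`, with the normalisation's modulus at its floor `ζ`). [folklore] -/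
noncomputable def ampOp (ρ₀ : ℝ) : ℝ :=
  ((𝔠.cG + 𝔠.κQ * 𝔠.W * 𝔠.Kk + Real.exp 1 * 𝔠.u * (𝔠.κR * 𝔱.n₀K 𝔠))
        * (2 + 4 * (𝔠.κP * 𝔠.K) * 𝔠.M₀' / (Real.exp 1 * 𝔠.u₀ * 𝔠.ζ)) / (Real.exp 1 * 𝔠.u)
      + 4 * (𝔠.κP * 𝔠.K) * 𝔠.M₀' / (Real.exp 1 * 𝔠.u₀ * 𝔠.ζ))
    * (2 * Real.exp (𝔱.βbar 𝔠 ρ₀) * 𝔠.M' / 𝔠.ζ)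

/-- THE HISTORY AMPLITUDE of the term's two-species slot (the coefficient of `δ_h = ‖q.2 − p.2‖/ϱHist`). [folklore] -/
noncomputable def ampHist (ρ₀ : ℝ) : ℝ :=
  𝔱.n₀K 𝔠 * (2 + 4 * (𝔠.κP * 𝔠.K) * 𝔠.M₀' / (Real.exp 1 * 𝔠.u₀ * 𝔠.ζ)) * (2 * Real.exp (𝔱.βbar 𝔠 ρ₀) * 𝔠.M' / 𝔠.ζ)

omit [Fintype ι] [Fintype κ] in
/-- [folklore] The history modulus is nonnegative for `K'' ≥ 0`. -/
theorem n₀K_nonneg (hK'' : 0 ≤ 𝔠.K'') : 0 ≤ 𝔱.n₀K 𝔠 := mul_nonneg (Nat.cast_nonneg _) hK''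

omit [Fintype ι] [Fintype κ] in
/-- [folklore] The amplitudes and the size are nonnegative on the admissible range. -/
theorem amp_nonneg (h : 𝔠.Admissible) (ρ₀ : ℝ) :
    0 ≤ 𝔱.ampOp 𝔠 ρ₀ ∧ 0 ≤ 𝔱.ampHist 𝔠 ρ₀ ∧ 0 ≤ 𝔠.size := by
  have hn := 𝔱.n₀K_nonneg 𝔠 h.hK''
  have := h.hκP; have := h.hK; have := h.hM₀'; have := h.hM'; have := h.hζ; have := h.hu; have := h.hu₀
  have := h.hκQ; have := h.hW; have := h.hKk; have := h.hκR; have := h.hm; have := h.hκL; have := h.hcP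
  have := h.hc; have := h.hκA
  have hc'0 : 0 ≤ 𝔠.c' := le_trans (div_nonneg h.hc (by linarith [h.hsA])) h.hc'
  have hcP'0 : 0 ≤ 𝔠.cP' := le_trans (div_nonneg h.hcP (by linarith [h.hsP])) h.hcP'
  have hcG : 0 ≤ 𝔠.cG := le_trans (by positivity) h.hcG
  unfold ampOp ampHist TermConsts.size
  exact ⟨by positivity, by positivity, by positivity⟩

end TermDatum

end Summit.QuantumFields.BalabanUV.T4Continuum.ActivityTermModel
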